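import Summits.MatrixMultiplication.MatrixMultiplication.Theorems.SnSubsetDichotomyGlobalBranchStubFlatCase
import Summits.MatrixMultiplication.MatrixMultiplication.Theorems.SnSubsetDichotomyGlobalBranchStubUmvirateParseval
import Summits.MatrixMultiplication.MatrixMultiplication.Theorems.SnSubsetDichotomyGlobalBranchStubPartitionNumerics
import Literature.NumberTheory.DiophantineGeometry.SymmetricGroupRepsSignTwist

/-!
# The combinatorial flat case of `GlobalBranch` (crux stmt-MatrixMultiplication-8303, line flat-tail-truncation)

Stub `stub_flatCaseUmv`: **a TPP triple in `𝔖ₙ` all of whose sets have L²-flat umvirate statistics at every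
level `1 ≤ ℓ ≤ ⌊√n⌋ is sub-threshold** — the planner's original (combinatorial) flat case, from the spectral
flat case `stub_flatCase` through the umvirate Parseval inequality `stub_umvirateParseval`: the planner's
`uF ℓ X = Σ_{I,L}(|X ∩ U_{I→L}|/|X| - 1/n^{(ℓ)})²` dominates the spectral row mass (`flatCaseUmv_specMass_le`:
`|X|²·uF = Σ_{I,L}|X∩U_{I→L}|² - |X|²` and stub 9 with `f = 1_X`), and the sign-twisted `uS` dominates the
column mass (stub 9 with `f = sgn·1_X`, `χ^{μᵀ} = sgn·χ^μ`, `(μᵀ)₁ = μ₁'`).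
-/

set_option linter.dupNamespace false

open scoped BigOperators Matrix ComplexOrder
open Finset
open Literature.Combinatorics.Additive (TripleProductProperty indicatorElem indicatorElemInv)
open Literature.NumberTheory.DiophantineGeometry (numStandardTableaux spechtCharacter)
open Literature.RepresentationTheory.FiniteGroups (BlockAlgebraC blockRep)

namespace Summit.MatrixMultiplication.MatrixMultiplication.Theorems.GlobalBranch

open Literature.NumberTheory.DiophantineGeometry (spechtCharacter_transpose)

section UmvBridge

variable {n ℓ : ℕ}

/-- Summing a weight over the umvirates `U_{I→L}` with a fixed injective source `I` recovers the
sum over `X` (these umvirates partition `𝔖ₙ`). [folklore] -/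
theorem flatCaseUmv_sum_sum_filter (I : Fin ℓ ↪ Fin n) (X : Finset (Equiv.Perm (Fin n)))
    (w : Equiv.Perm (Fin n) → ℝ) :
    ∑ L : Fin ℓ ↪ Fin n, ∑ σ ∈ X.filter (fun σ => ∀ k, σ (I k) = L k), w σ = ∑ σ ∈ X, w σ := by
  -- (no classical: keep the Fin instances syntactic)
  -- adapted from Cruxes/GlobalBranch/Disproof.lean (sum_card_univ_umvirate)
  rw [← Finset.sum_fiberwise_of_maps_to (s := X) (t := (Finset.univ : Finset (Fin ℓ ↪ Fin n)))
    (g := fun σ : Equiv.Perm (Fin n) => (⟨σ ∘ I, σ.injective.comp I.injective⟩ : Fin ℓ ↪ Fin n))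
    (fun _ _ => Finset.mem_univ _)]
  refine Finset.sum_congr rfl fun L _ => Finset.sum_congr ?_ fun _ _ => rfl
  ext σ
  simp only [Finset.mem_filter, and_congr_right_iff]
  intro _
  constructor
  · intro hσ
    exact Function.Embedding.ext fun k => by simpa using hσ k
  · intro hσ k
    have := congrArg (fun e : Fin ℓ ↪ Fin n => e k) hσ
    simpa using this

/-- The algebra of the planner's flatness: for `c ≠ 0` and a family `a_{I,L}` with
`Σ_L a_{I,L} = s` for every `I` (`d` sources),
`c² Σ_{I,L} (a/c - s/c/d)² = Σ_{I,L} a² - s²`. [folklore] -/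
theorem flatCaseUmv_sq_expand {ι : Type*} [Fintype ι] (a : ι → ι → ℝ) (c s d : ℝ) (hc : c ≠ 0)
    (hd : d ≠ 0) (hcard : (((Finset.univ : Finset ι).card : ℕ) : ℝ) = d) (hrow : ∀ I, ∑ L, a I L = s) :
    c ^ 2 * ∑ I, ∑ L, (a I L / c - s / c / d) ^ 2 = (∑ I, ∑ L, a I L ^ 2) - s ^ 2 := by
  set t : ℝ := s / d with ht
  have hs : s = t * d := by rw [ht, div_mul_cancel₀ s hd]
  have hsum : ∑ I, ∑ L, a I L = d * s := by
    simp only [hrow, Finset.sum_const, nsmul_eq_mul, hcard]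
  have step1 : ∀ I L, c ^ 2 * (a I L / c - s / c / d) ^ 2 = (a I L - t) ^ 2 := by
    intro I L
    have e : a I L / c - s / c / d = (a I L - t) / c := by
      rw [div_right_comm, ← ht, ← sub_div]
    rw [e, div_pow, ← mul_div_assoc, mul_div_cancel_left₀ _ (pow_ne_zero 2 hc)]
  calc c ^ 2 * ∑ I, ∑ L, (a I L / c - s / c / d) ^ 2 = ∑ I, ∑ L, (a I L - t) ^ 2 := by
        rw [Finset.mul_sum]
        refine Finset.sum_congr rfl fun I _ => ?_
        rw [Finset.mul_sum]
        exact Finset.sum_congr rfl fun L _ => step1 I L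
    _ = ∑ I, ∑ L, (a I L ^ 2 - 2 * t * a I L + t ^ 2) := by
        refine Finset.sum_congr rfl fun I _ => Finset.sum_congr rfl fun L _ => ?_
        ring
    _ = (∑ I, ∑ L, a I L ^ 2) - 2 * t * (∑ I, ∑ L, a I L) + d * (d * t ^ 2) := by
        simp only [Finset.sum_add_distrib, Finset.sum_sub_distrib, ← Finset.mul_sum, Finset.sum_const,
          nsmul_eq_mul, hcard]
    _ = (∑ I, ∑ L, a I L ^ 2) - s ^ 2 := by
        rw [hsum, hs]
        ring

/-- **Row bridge**: the spectral level-`ℓ` row mass is at most the planner's `umvFlat`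
(`1 ≤ ℓ ≤ n`). -/
theorem flatCaseUmv_specMass_le (hℓ : ℓ ≤ n) (X : Finset (Equiv.Perm (Fin n))) :
    (∑ μ ∈ univ.filter (fun μ : Nat.Partition n =>
        μ ≠ Nat.Partition.indiscrete n ∧ μ.parts.sup = n - ℓ),
      ∑ x ∈ X, ∑ y ∈ X, (spechtCharacter ℂ μ (x⁻¹ * y)).re) / ((X.card : ℝ) ^ 2) ≤
    ∑ I : Fin ℓ ↪ Fin n, ∑ L : Fin ℓ ↪ Fin n,
      (((X.filter (fun σ => ∀ k, σ (I k) = L k)).card : ℝ) / (X.card : ℝ) -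
        1 / (n.descFactorial ℓ : ℝ)) ^ 2 := by
  -- (no classical: keep the Fin instances syntactic)
  by_cases hX : X.card = 0
  · have hX' : X = ∅ := Finset.card_eq_zero.1 hX
    subst hX'
    simp only [Finset.sum_empty, Finset.sum_const_zero, zero_div]
    positivity
  have hc : (X.card : ℝ) ≠ 0 := by exact_mod_cast hX
  have hcpos : (0 : ℝ) < (X.card : ℝ) ^ 2 := by positivity
  -- stub 9 with `f = 1_X`
  set f : Equiv.Perm (Fin n) → ℂ := fun σ => if σ ∈ X then 1 else 0 with hf
  have key := stub_umvirateParseval n ℓ hℓ f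
  -- the left side of stub 9 is the family character sum over `μ₁ ≥ n - ℓ`
  have hconj : ∀ x, (starRingEnd ℂ) (f x) = f x := fun x => by
    simp only [hf]; split_ifs <;> simp
  have hL : ∀ μ : Nat.Partition n,
      (∑ x : Equiv.Perm (Fin n), ∑ y : Equiv.Perm (Fin n),
        (starRingEnd ℂ) (f x) * f y * spechtCharacter ℂ μ (x⁻¹ * y)).re =
      ∑ x ∈ X, ∑ y ∈ X, (spechtCharacter ℂ μ (x⁻¹ * y)).re := by
    intro μ
    simp only [hconj]
    have h2 : ∀ x, ∑ y : Equiv.Perm (Fin n), f x * f y * spechtCharacter ℂ μ (x⁻¹ * y) =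
        ∑ y ∈ X, f x * spechtCharacter ℂ μ (x⁻¹ * y) := by
      intro x
      rw [← Finset.sum_filter_add_sum_filter_not Finset.univ (fun y => y ∈ X)]
      have hz : ∑ y ∈ Finset.univ.filter (fun y => ¬ y ∈ X), f x * f y * spechtCharacter ℂ μ (x⁻¹ * y) = 0 :=
        Finset.sum_eq_zero fun y hy => by
          simp only [Finset.mem_filter] at hy
          simp only [hf, if_neg hy.2, mul_zero, zero_mul]
      rw [hz, add_zero, Finset.filter_mem_eq_inter, Finset.univ_inter]
      refine Finset.sum_congr rfl fun y hy => ?_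
      simp only [hf, if_pos hy, mul_one]
    simp only [h2]
    rw [← Finset.sum_filter_add_sum_filter_not Finset.univ (fun x => x ∈ X)]
    have hz : ∑ x ∈ Finset.univ.filter (fun x => ¬ x ∈ X), ∑ y ∈ X, f x * spechtCharacter ℂ μ (x⁻¹ * y) = 0 :=
      Finset.sum_eq_zero fun x hx => by
        simp only [Finset.mem_filter] at hx
        simp only [hf, if_neg hx.2, zero_mul, Finset.sum_const_zero]
    rw [hz, add_zero, Finset.filter_mem_eq_inter, Finset.univ_inter, Complex.re_sum]
    refine Finset.sum_congr rfl fun x hx => ?_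
    rw [Complex.re_sum]
    refine Finset.sum_congr rfl fun y _ => ?_
    simp only [hf, if_pos hx, one_mul]
  simp only [hL] at key
  -- the right side of stub 9
  have hsumf : ∀ I L : Fin ℓ ↪ Fin n,
      ∑ σ ∈ univ.filter (fun σ : Equiv.Perm (Fin n) => ∀ k, σ (I k) = L k), f σ =
        (((X.filter (fun σ => ∀ k, σ (I k) = L k)).card : ℕ) : ℂ) := by
    intro I L
    simp only [hf]
    rw [Finset.sum_ite_mem, Finset.sum_const, nsmul_eq_mul, mul_one]
    congr 2
    ext σ; simp [and_comm]
  have htot : ∑ σ : Equiv.Perm (Fin n), f σ = ((X.card : ℕ) : ℂ) := by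
    simp only [hf]
    rw [Finset.sum_ite_mem, Finset.univ_inter, Finset.sum_const, nsmul_eq_mul, mul_one]
  have hnorm : ∀ m : ℕ, ‖((m : ℕ) : ℂ)‖ ^ 2 = (m : ℝ) ^ 2 := fun m => by
    rw [Complex.norm_natCast]
  simp only [hsumf, htot, hnorm] at key
  -- compare: family `μ₁ = n - ℓ` ⊆ family `μ₁ ≥ n - ℓ`, all character sums ≥ 0
  have hsub : (∑ μ ∈ univ.filter (fun μ : Nat.Partition n =>
        μ ≠ Nat.Partition.indiscrete n ∧ μ.parts.sup = n - ℓ),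
      ∑ x ∈ X, ∑ y ∈ X, (spechtCharacter ℂ μ (x⁻¹ * y)).re) ≤
      ∑ μ ∈ univ.filter (fun μ : Nat.Partition n =>
        μ ≠ Nat.Partition.indiscrete n ∧ n - ℓ ≤ μ.parts.sup),
      ∑ x ∈ X, ∑ y ∈ X, (spechtCharacter ℂ μ (x⁻¹ * y)).re := by
    refine Finset.sum_le_sum_of_subset_of_nonneg ?_ (fun μ _ _ => flatCase_charSum_nonneg μ X)
    intro μ hμ
    simp only [Finset.mem_filter, Finset.mem_univ, true_and] at hμ ⊢
    exact ⟨hμ.1, hμ.2.symm.le⟩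
  -- the planner's flatness, multiplied out
  have hexp : (X.card : ℝ) ^ 2 * ∑ I : Fin ℓ ↪ Fin n, ∑ L : Fin ℓ ↪ Fin n,
      (((X.filter (fun σ => ∀ k, σ (I k) = L k)).card : ℝ) / (X.card : ℝ) -
        1 / (n.descFactorial ℓ : ℝ)) ^ 2 =
      (∑ I : Fin ℓ ↪ Fin n, ∑ L : Fin ℓ ↪ Fin n,
        (((X.filter (fun σ => ∀ k, σ (I k) = L k)).card : ℝ)) ^ 2) - (X.card : ℝ) ^ 2 := by
    have hcard : ((((Finset.univ : Finset (Fin ℓ ↪ Fin n)).card : ℕ) : ℝ)) = (n.descFactorial ℓ : ℝ) := by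
      have h : (Finset.univ : Finset (Fin ℓ ↪ Fin n)).card = n.descFactorial ℓ := by
        rw [Finset.card_univ, Fintype.card_embedding_eq, Fintype.card_fin, Fintype.card_fin]
      rw [h]
    have hdne : n.descFactorial ℓ ≠ 0 := by
      intro h0
      exact (not_lt.2 hℓ) (Nat.descFactorial_eq_zero_iff_lt.1 h0)
    have hd0 : (n.descFactorial ℓ : ℝ) ≠ 0 := by exact_mod_cast hdne
    set a : (Fin ℓ ↪ Fin n) → (Fin ℓ ↪ Fin n) → ℝ :=
      fun I L => (((X.filter (fun σ => ∀ k, σ (I k) = L k)).card : ℝ)) with ha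
    have hrow : ∀ I : Fin ℓ ↪ Fin n, ∑ L : Fin ℓ ↪ Fin n, a I L = (X.card : ℝ) := by
      intro I
      have h := flatCaseUmv_sum_sum_filter I X (fun _ => (1 : ℝ))
      simpa [ha] using h
    have h := flatCaseUmv_sq_expand a (X.card : ℝ) (X.card : ℝ) (n.descFactorial ℓ : ℝ) hc hd0 hcard hrow
    have hone : (X.card : ℝ) / (X.card : ℝ) / (n.descFactorial ℓ : ℝ) = 1 / (n.descFactorial ℓ : ℝ) := by
      rw [div_self hc]
    rw [hone] at h
    exact h
  rw [div_le_iff₀ hcpos, mul_comm, hexp]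
  exact hsub.trans key

/-- **Column bridge**: the spectral level-`ℓ` column mass is at most the planner's `umvFlatSgn`
(`1 ≤ ℓ ≤ n`). -/
theorem flatCaseUmv_specMassT_le (hn : 1 ≤ n) (hℓ1 : 1 ≤ ℓ) (hℓ : ℓ ≤ n) (X : Finset (Equiv.Perm (Fin n))) :
    (∑ μ ∈ univ.filter (fun μ : Nat.Partition n =>
        μ ≠ Nat.Partition.indiscrete n ∧ Multiset.card μ.parts = n - ℓ),
      ∑ x ∈ X, ∑ y ∈ X, (spechtCharacter ℂ μ (x⁻¹ * y)).re) / ((X.card : ℝ) ^ 2) ≤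
    ∑ I : Fin ℓ ↪ Fin n, ∑ L : Fin ℓ ↪ Fin n,
      ((∑ σ ∈ X.filter (fun σ => ∀ k, σ (I k) = L k), ((Equiv.Perm.sign σ : ℤ) : ℝ)) / (X.card : ℝ) -
        (∑ σ ∈ X, ((Equiv.Perm.sign σ : ℤ) : ℝ)) / (X.card : ℝ) / (n.descFactorial ℓ : ℝ)) ^ 2 := by
  -- (no classical: keep the Fin instances syntactic)
  by_cases hX : X.card = 0
  · have hX' : X = ∅ := Finset.card_eq_zero.1 hX
    subst hX'
    simp only [Finset.sum_empty, Finset.sum_const_zero, zero_div]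
    positivity
  have hc : (X.card : ℝ) ≠ 0 := by exact_mod_cast hX
  have hcpos : (0 : ℝ) < (X.card : ℝ) ^ 2 := by positivity
  -- stub 9 with `f = sgn · 1_X`
  set f : Equiv.Perm (Fin n) → ℂ := fun σ => if σ ∈ X then ((Equiv.Perm.sign σ : ℤ) : ℂ) else 0
    with hf
  have key := stub_umvirateParseval n ℓ hℓ f
  have hconj : ∀ x, (starRingEnd ℂ) (f x) = f x := fun x => by
    simp only [hf]; split_ifs <;> simp
  -- the left side: `Σ_{x,y∈X} sgn x sgn y χ^μ(x⁻¹y) = Σ_{x,y∈X} χ^{μᵀ}(x⁻¹y)`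
  have hsgn : ∀ (μ : Nat.Partition n) (x y : Equiv.Perm (Fin n)),
      ((Equiv.Perm.sign x : ℤ) : ℂ) * ((Equiv.Perm.sign y : ℤ) : ℂ) * spechtCharacter ℂ μ (x⁻¹ * y) =
        spechtCharacter ℂ μ.transpose (x⁻¹ * y) := by
    intro μ x y
    rw [spechtCharacter_transpose, Equiv.Perm.sign_mul, Equiv.Perm.sign_inv, Units.val_mul,
      Int.cast_mul]
  have hL : ∀ μ : Nat.Partition n,
      (∑ x : Equiv.Perm (Fin n), ∑ y : Equiv.Perm (Fin n),
        (starRingEnd ℂ) (f x) * f y * spechtCharacter ℂ μ (x⁻¹ * y)).re =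
      ∑ x ∈ X, ∑ y ∈ X, (spechtCharacter ℂ μ.transpose (x⁻¹ * y)).re := by
    intro μ
    simp only [hconj]
    have h2 : ∀ x, ∑ y : Equiv.Perm (Fin n), f x * f y * spechtCharacter ℂ μ (x⁻¹ * y) =
        ∑ y ∈ X, f x * ((Equiv.Perm.sign y : ℤ) : ℂ) * spechtCharacter ℂ μ (x⁻¹ * y) := by
      intro x
      rw [← Finset.sum_filter_add_sum_filter_not Finset.univ (fun y => y ∈ X)]
      have hz : ∑ y ∈ Finset.univ.filter (fun y => ¬ y ∈ X), f x * f y * spechtCharacter ℂ μ (x⁻¹ * y) = 0 :=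
        Finset.sum_eq_zero fun y hy => by
          simp only [Finset.mem_filter] at hy
          simp only [hf, if_neg hy.2, mul_zero, zero_mul]
      rw [hz, add_zero, Finset.filter_mem_eq_inter, Finset.univ_inter]
      refine Finset.sum_congr rfl fun y hy => ?_
      simp only [hf, if_pos hy]
    simp only [h2]
    rw [← Finset.sum_filter_add_sum_filter_not Finset.univ (fun x => x ∈ X)]
    have hz : ∑ x ∈ Finset.univ.filter (fun x => ¬ x ∈ X),
        ∑ y ∈ X, f x * ((Equiv.Perm.sign y : ℤ) : ℂ) * spechtCharacter ℂ μ (x⁻¹ * y) = 0 :=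
      Finset.sum_eq_zero fun x hx => by
        simp only [Finset.mem_filter] at hx
        simp only [hf, if_neg hx.2, zero_mul, Finset.sum_const_zero]
    rw [hz, add_zero, Finset.filter_mem_eq_inter, Finset.univ_inter, Complex.re_sum]
    refine Finset.sum_congr rfl fun x hx => ?_
    rw [Complex.re_sum]
    refine Finset.sum_congr rfl fun y _ => ?_
    simp only [hf, if_pos hx]
    rw [hsgn]
  simp only [hL] at key
  -- the right side of stub 9
  have hsumf : ∀ I L : Fin ℓ ↪ Fin n,
      ∑ σ ∈ univ.filter (fun σ : Equiv.Perm (Fin n) => ∀ k, σ (I k) = L k), f σ =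
        ((∑ σ ∈ X.filter (fun σ => ∀ k, σ (I k) = L k), ((Equiv.Perm.sign σ : ℤ) : ℝ) : ℝ) : ℂ) := by
    intro I L
    simp only [hf]
    rw [Finset.sum_ite_mem, Complex.ofReal_sum]
    have hset : univ.filter (fun σ : Equiv.Perm (Fin n) => ∀ k, σ (I k) = L k) ∩ X =
        X.filter (fun σ => ∀ k, σ (I k) = L k) := by
      ext σ; simp [and_comm]
    rw [hset]
    refine Finset.sum_congr rfl fun σ _ => ?_
    push_cast; rfl
  have htot : ∑ σ : Equiv.Perm (Fin n), f σ = ((∑ σ ∈ X, ((Equiv.Perm.sign σ : ℤ) : ℝ) : ℝ) : ℂ) := by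
    simp only [hf]
    rw [Finset.sum_ite_mem, Finset.univ_inter, Complex.ofReal_sum]
    refine Finset.sum_congr rfl fun σ _ => ?_
    push_cast; rfl
  have hnorm : ∀ r : ℝ, ‖(r : ℂ)‖ ^ 2 = r ^ 2 := fun r => by
    rw [Complex.norm_real, Real.norm_eq_abs, sq_abs]
  simp only [hsumf, htot, hnorm] at key
  -- compare: column family at level ℓ, transposed, sits inside the row family `μ₁ ≥ n - ℓ`
  have hn0 : n ≠ 0 := by omega
  have hsub : (∑ μ ∈ univ.filter (fun μ : Nat.Partition n =>
        μ ≠ Nat.Partition.indiscrete n ∧ Multiset.card μ.parts = n - ℓ),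
      ∑ x ∈ X, ∑ y ∈ X, (spechtCharacter ℂ μ (x⁻¹ * y)).re) ≤
      ∑ μ ∈ univ.filter (fun μ : Nat.Partition n =>
        μ ≠ Nat.Partition.indiscrete n ∧ n - ℓ ≤ μ.parts.sup),
      ∑ x ∈ X, ∑ y ∈ X, (spechtCharacter ℂ μ.transpose (x⁻¹ * y)).re := by
    -- reindex the left sum by `μ ↦ μᵀ`
    have hinj : ∀ a ∈ univ.filter (fun μ : Nat.Partition n =>
          μ ≠ Nat.Partition.indiscrete n ∧ Multiset.card μ.parts = n - ℓ),
        ∀ b ∈ univ.filter (fun μ : Nat.Partition n =>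
          μ ≠ Nat.Partition.indiscrete n ∧ Multiset.card μ.parts = n - ℓ),
        a.transpose = b.transpose → a = b := by
      intro a _ b _ h
      have := congrArg Nat.Partition.transpose h
      simpa [Nat.Partition.transpose_transpose] using this
    have e1 : (∑ μ ∈ univ.filter (fun μ : Nat.Partition n =>
        μ ≠ Nat.Partition.indiscrete n ∧ Multiset.card μ.parts = n - ℓ),
      ∑ x ∈ X, ∑ y ∈ X, (spechtCharacter ℂ μ (x⁻¹ * y)).re) =
      ∑ μ ∈ (univ.filter (fun μ : Nat.Partition n =>
        μ ≠ Nat.Partition.indiscrete n ∧ Multiset.card μ.parts = n - ℓ)).image Nat.Partition.transpose,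
      ∑ x ∈ X, ∑ y ∈ X, (spechtCharacter ℂ μ.transpose (x⁻¹ * y)).re := by
      rw [Finset.sum_image hinj]
      refine Finset.sum_congr rfl fun ν _ => ?_
      rw [Nat.Partition.transpose_transpose]
    rw [e1]
    refine Finset.sum_le_sum_of_subset_of_nonneg ?_
      (fun μ _ _ => flatCase_charSum_nonneg μ.transpose X)
    intro μ hμ
    simp only [Finset.mem_image, Finset.mem_filter, Finset.mem_univ, true_and] at hμ ⊢
    obtain ⟨ν, ⟨hν1, hν2⟩, rfl⟩ := hμ
    have hsupT : ν.transpose.parts.sup = Multiset.card ν.parts := partitionNumerics_sup_parts_transpose ν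
    refine ⟨?_, ?_⟩
    · intro hind
      have h1 : ν.transpose.parts.sup = n := by
        rw [hind, Nat.Partition.indiscrete_parts hn0, Multiset.sup_singleton]
      omega
    · omega
  -- the planner's twisted flatness, multiplied out
  have hexp : (X.card : ℝ) ^ 2 * ∑ I : Fin ℓ ↪ Fin n, ∑ L : Fin ℓ ↪ Fin n,
      ((∑ σ ∈ X.filter (fun σ => ∀ k, σ (I k) = L k), ((Equiv.Perm.sign σ : ℤ) : ℝ)) / (X.card : ℝ) -
        (∑ σ ∈ X, ((Equiv.Perm.sign σ : ℤ) : ℝ)) / (X.card : ℝ) / (n.descFactorial ℓ : ℝ)) ^ 2 =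
      (∑ I : Fin ℓ ↪ Fin n, ∑ L : Fin ℓ ↪ Fin n,
        (∑ σ ∈ X.filter (fun σ => ∀ k, σ (I k) = L k), ((Equiv.Perm.sign σ : ℤ) : ℝ)) ^ 2) -
        (∑ σ ∈ X, ((Equiv.Perm.sign σ : ℤ) : ℝ)) ^ 2 := by
    have hcard : ((((Finset.univ : Finset (Fin ℓ ↪ Fin n)).card : ℕ) : ℝ)) = (n.descFactorial ℓ : ℝ) := by
      have h : (Finset.univ : Finset (Fin ℓ ↪ Fin n)).card = n.descFactorial ℓ := by
        rw [Finset.card_univ, Fintype.card_embedding_eq, Fintype.card_fin, Fintype.card_fin]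
      rw [h]
    have hdne : n.descFactorial ℓ ≠ 0 := by
      intro h0
      exact (not_lt.2 hℓ) (Nat.descFactorial_eq_zero_iff_lt.1 h0)
    have hd0 : (n.descFactorial ℓ : ℝ) ≠ 0 := by exact_mod_cast hdne
    set a : (Fin ℓ ↪ Fin n) → (Fin ℓ ↪ Fin n) → ℝ :=
      fun I L => ∑ σ ∈ X.filter (fun σ => ∀ k, σ (I k) = L k), ((Equiv.Perm.sign σ : ℤ) : ℝ) with ha
    have hrow : ∀ I : Fin ℓ ↪ Fin n, ∑ L : Fin ℓ ↪ Fin n, a I L = ∑ σ ∈ X, ((Equiv.Perm.sign σ : ℤ) : ℝ) :=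
      fun I => flatCaseUmv_sum_sum_filter I X (fun σ => ((Equiv.Perm.sign σ : ℤ) : ℝ))
    exact flatCaseUmv_sq_expand a (X.card : ℝ) (∑ σ ∈ X, ((Equiv.Perm.sign σ : ℤ) : ℝ))
      (n.descFactorial ℓ : ℝ) hc hd0 hcard hrow
  rw [div_le_iff₀ hcpos, mul_comm, hexp]
  exact hsub.trans key

end UmvBridge

set_option maxHeartbeats 400000 in
/-- **The combinatorial flat case of `GlobalBranch`** (stub `stub_flatCaseUmv` of the line
`flat-tail-truncation`; the planner's original flat case): for some absolute `c > 0` and all large `n`,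
every triple `S, T, U ⊆ 𝔖ₙ` with the triple product property all of whose sets satisfy, at every
level `1 ≤ ℓ ≤ ⌊√n⌋`, the L²-flatness of their umvirate statistics
`n^{(ℓ)}·(uF ℓ X)³ ≤ 8^{-ℓ}` and `n^{(ℓ)}·(uS ℓ X)³ ≤ 8^{-ℓ}` — where
`uF ℓ X = Σ_{I,L}(|X ∩ U_{I→L}|/|X| - 1/n^{(ℓ)})²` over injective `I, L : Fin ℓ ↪ Fin n`,
`U_{I→L} = {σ : σ∘I = L}`, and `uS` is the same for the signed indicator — has
`|S||T||U| ≤ (n!)^{3/2} e^{-c√n}`. -/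
theorem stub_flatCaseUmv :
    ∃ c : ℝ, 0 < c ∧ ∃ n₃ : ℕ, ∀ n ≥ n₃,
      ∀ (uF uS : ℕ → Finset (Equiv.Perm (Fin n)) → ℝ),
      (∀ (ℓ : ℕ) (X : Finset (Equiv.Perm (Fin n))), uF ℓ X =
        ∑ I : Fin ℓ ↪ Fin n, ∑ L : Fin ℓ ↪ Fin n,
          (((X.filter (fun σ => ∀ k, σ (I k) = L k)).card : ℝ) / (X.card : ℝ) -
            1 / (n.descFactorial ℓ : ℝ)) ^ 2) →
      (∀ (ℓ : ℕ) (X : Finset (Equiv.Perm (Fin n))), uS ℓ X =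
        ∑ I : Fin ℓ ↪ Fin n, ∑ L : Fin ℓ ↪ Fin n,
          ((∑ σ ∈ X.filter (fun σ => ∀ k, σ (I k) = L k), ((Equiv.Perm.sign σ : ℤ) : ℝ)) /
              (X.card : ℝ) -
            (∑ σ ∈ X, ((Equiv.Perm.sign σ : ℤ) : ℝ)) / (X.card : ℝ) / (n.descFactorial ℓ : ℝ)) ^ 2) →
      ∀ S T U : Finset (Equiv.Perm (Fin n)), TripleProductProperty S T U →
      (∀ X : Finset (Equiv.Perm (Fin n)), (X = S ∨ X = T ∨ X = U) →
        ∀ ℓ : ℕ, 1 ≤ ℓ → ℓ ≤ Nat.sqrt n →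
          (n.descFactorial ℓ : ℝ) * uF ℓ X ^ 3 ≤ (1 / 8 : ℝ) ^ ℓ ∧
            (n.descFactorial ℓ : ℝ) * uS ℓ X ^ 3 ≤ (1 / 8 : ℝ) ^ ℓ) →
      ((S.card * T.card * U.card : ℕ) : ℝ) ≤
        (n.factorial : ℝ) ^ ((3 : ℝ) / 2) * Real.exp (-(c * Real.sqrt (n : ℝ))) := by
  obtain ⟨c, hc, n₃, h⟩ := stub_flatCase
  refine ⟨c, hc, max n₃ 1, fun n hn uF uS huF huS S T U hTPP hflat => ?_⟩
  have hn₃ : n₃ ≤ n := le_trans (le_max_left _ _) hn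
  have hn1 : 1 ≤ n := le_trans (le_max_right _ _) hn
  -- the spectral masses, as literal functions
  set sM : ℕ → Finset (Equiv.Perm (Fin n)) → ℝ := fun ℓ X =>
    (∑ μ ∈ univ.filter (fun μ : Nat.Partition n =>
        μ ≠ Nat.Partition.indiscrete n ∧ μ.parts.sup = n - ℓ),
      ∑ x ∈ X, ∑ y ∈ X, (spechtCharacter ℂ μ (x⁻¹ * y)).re) / ((X.card : ℝ) ^ 2) with hsM
  set sT : ℕ → Finset (Equiv.Perm (Fin n)) → ℝ := fun ℓ X =>
    (∑ μ ∈ univ.filter (fun μ : Nat.Partition n =>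
        μ ≠ Nat.Partition.indiscrete n ∧ Multiset.card μ.parts = n - ℓ),
      ∑ x ∈ X, ∑ y ∈ X, (spechtCharacter ℂ μ (x⁻¹ * y)).re) / ((X.card : ℝ) ^ 2) with hsT
  refine h n hn₃ sM sT (fun _ _ => rfl) (fun _ _ => rfl) S T U hTPP ?_
  intro X hX ℓ h1 h2
  have hℓn : ℓ ≤ n := h2.trans (Nat.sqrt_le_self n)
  obtain ⟨hA, hB⟩ := hflat X hX ℓ h1 h2
  have hsM0 : 0 ≤ sM ℓ X :=
    div_nonneg (Finset.sum_nonneg fun μ _ => flatCase_charSum_nonneg μ X) (by positivity)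
  have hsT0 : 0 ≤ sT ℓ X :=
    div_nonneg (Finset.sum_nonneg fun μ _ => flatCase_charSum_nonneg μ X) (by positivity)
  have hMle : sM ℓ X ≤ uF ℓ X := by
    rw [huF]; exact flatCaseUmv_specMass_le hℓn X
  have hTle : sT ℓ X ≤ uS ℓ X := by
    rw [huS]; exact flatCaseUmv_specMassT_le hn1 h1 hℓn X
  have hN : (0 : ℝ) ≤ (n.descFactorial ℓ : ℝ) := Nat.cast_nonneg _
  constructor
  · calc (n.descFactorial ℓ : ℝ) * sM ℓ X ^ 3 ≤ (n.descFactorial ℓ : ℝ) * uF ℓ X ^ 3 := by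
          gcongr
      _ ≤ _ := hA
  · calc (n.descFactorial ℓ : ℝ) * sT ℓ X ^ 3 ≤ (n.descFactorial ℓ : ℝ) * uS ℓ X ^ 3 := by
          gcongr
      _ ≤ _ := hB

end Summit.MatrixMultiplication.MatrixMultiplication.Theorems.GlobalBranch
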